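import Mathlib
import HarnessLib

/-!
# HANDOFF — MAJORANT SEQUENCES and a discrete GRÖNWALL bound for the dodger's cumulant recursion (rh-explicit, track «HANDOFF», seat prove-2 gen10, ATTEMPT-19 §2)

HONEST FRAMING. Nothing here bears on the truth of RH; this is elementary real analysis (finite sums, one derivative, `Real.exp`),
Mathlib-only. It is the SIZE engine of ATTEMPT-16's Lemma D1 (profile control on the collar), made algebraic as announced in
ATTEMPT-18 §3 (δ′) and freed of formal `exp ∘ log` of power series.

SETTING. A complex sequence `r` with `r_0 = 1` satisfying the CUMULANT RECURSION `(n+1)·r_{n+1} = −Σ_{i<n} S_{i+2}·r_{n−1−i}`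
(so `r_1 = 0`, `r_2 = −S_2/2`, …; for the dodger: `r = e^{p₁X}·H`, `H = P̃/Λ̃`, `S_j` = the power sums `Σ_ρ m z_ρ^{2j} − Σ_k ν_k^j` — `HandoffDodgerNewton`), and real bounds
`‖S_j‖ ≤ s_j` (`j ≥ 2`). DEFINE the MAJORANT SEQUENCE `majorSeq s` by the same recursion without the sign
(`r̄_0 = 1`, `(n+1)r̄_{n+1} = Σ_{i<n} s_{i+2}r̄_{n−1−i}`; these are the coefficients of `exp(Σ_{j≥2} s_jX^j/j)`, a fact we never use).
THEOREMS. (1) `‖r_n‖ ≤ r̄_n` (`norm_le_majorSeq`, induction). (2) **Discrete Grönwall** (`sum_majorSeq_mul_pow_le_exp`): for `u ≥ 0` and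
every `N`, `Σ_{i≤N} r̄_i u^i ≤ exp(Σ_{m<N−1} s_{m+2} u^{m+2}/(m+2))` — proof: the polynomial `T(v) = Σ_{i≤N} r̄_iv^i` satisfies `T′ ≤ G′·T` on `v ≥ 0` with `G(v) = Σ s_{m+2}v^{m+2}/(m+2)` (the recursion, a triangle
re-summation `Finset.sum_range_diag_flip`, and positivity), so `T·e^{−G}` is non-increasing and `≤ T(0) = 1`. (3) Cauchy-type corollaries:
`r̄_n ≤ e^{G_n(u)}/uⁿ` (`majorSeq_le_exp_div_pow`). (4) For a sequence `h_n = Σ_{j≤n} (−p)^{n−j}/(n−j)!·r_j` (`p > 0`; for the dodger `h` =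
the coefficients of `H`, `p = p₁`): `‖h_n − (−p)ⁿ/n!‖ ≤ (pⁿ/n!)·(e^{G_n(n/p)} − 1)` (`norm_sub_le_mul_expm1`, via `n!/(n−j)! ≤ n^j`) and
`‖h_n‖ ≤ e^{pu + G_n(u)}/uⁿ` for every `u > 0` (`norm_le_exp_div_pow`). (5) With the geometric cumulant bound `s_j ≤ j·W^{j−1}·P`:
`G_n(u) ≤ 2PWu²` for `Wu ≤ ½` (`cumulantSum_le`), hence the two forms consumed by the profile lemma:
`‖h_n − (−p)ⁿ/n!‖ ≤ (pⁿ/n!)(exp(2PWn²/p²) − 1)` when `Wn ≤ p/2` (`norm_sub_le_of_geometric`) and `‖h_n‖ ≤ e^{pu+2PWu²}/uⁿ`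
(`norm_le_of_geometric`). No `sorry`, standard axioms; one definition (`majorSeq`).

References: this track (ATTEMPT-16 §5 Lemma D1; ATTEMPT-18 §3 (δ′); ATTEMPT-19 §2). Folklore (majorant method, Grönwall).
-/

set_option linter.dupNamespace false

noncomputable section

open Finset Real

namespace Summit.RiemannHypothesis.RiemannHypothesis.Theorems.Handoff

/-! ## The majorant sequence -/

/-- The MAJORANT SEQUENCE of a bound sequence `s`: `r̄_0 = 1`, `r̄_{n+1} = (Σ_{i<n} s_{i+2}·r̄_{n−1−i})/(n+1)`
(so `r̄_1 = 0`, `r̄_2 = s_2/2`). [this track, ATTEMPT-19 §2; folklore (majorant method)] -/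
def majorSeq (s : ℕ → ℝ) : ℕ → ℝ
  | 0 => 1
  | n + 1 => (∑ i ∈ Finset.range n, s (i + 2) * majorSeq s (n - 1 - i)) / ((n : ℝ) + 1)
decreasing_by omega

/-- `r̄_0 = 1`. [this track, ATTEMPT-19 §2] -/
@[simp] theorem majorSeq_zero (s : ℕ → ℝ) : majorSeq s 0 = 1 := by
  rw [majorSeq]

/-- The defining recursion. [this track, ATTEMPT-19 §2] -/
theorem majorSeq_succ (s : ℕ → ℝ) (n : ℕ) :
    majorSeq s (n + 1) = (∑ i ∈ Finset.range n, s (i + 2) * majorSeq s (n - 1 - i)) / ((n : ℝ) + 1) := by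
  rw [majorSeq]

/-- `r̄_1 = 0`. [this track, ATTEMPT-19 §2] -/
@[simp] theorem majorSeq_one (s : ℕ → ℝ) : majorSeq s 1 = 0 := by
  rw [majorSeq_succ]; simp

/-- The recursion, cleared of the denominator: `(n+1)·r̄_{n+1} = Σ_{i<n} s_{i+2}·r̄_{n−1−i}`. [this track, ATTEMPT-19 §2] -/
theorem majorSeq_succ_mul (s : ℕ → ℝ) (n : ℕ) :
    ((n : ℝ) + 1) * majorSeq s (n + 1) = ∑ i ∈ Finset.range n, s (i + 2) * majorSeq s (n - 1 - i) := by
  rw [majorSeq_succ]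
  field_simp

/-- `r̄_n ≥ 0` when the bounds `s_j` (`j ≥ 2`) are non-negative. [this track, ATTEMPT-19 §2] -/
theorem majorSeq_nonneg {s : ℕ → ℝ} (hs : ∀ j, 2 ≤ j → 0 ≤ s j) : ∀ n, 0 ≤ majorSeq s n := by
  intro n
  induction n using Nat.strong_induction_on with
  | _ n ih =>
    cases n with
    | zero => simp
    | succ n =>
      rw [majorSeq_succ]
      refine div_nonneg (Finset.sum_nonneg fun i hi => mul_nonneg (hs _ (by omega)) (ih _ ?_)) (by positivity)
      have := Finset.mem_range.1 hi
      omega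

/-! ## Domination -/

/-- **Domination.** A complex sequence with `r_0 = 1` obeying the cumulant recursion
`(n+1)r_{n+1} = −Σ_{i<n} S_{i+2}r_{n−1−i}` with `‖S_j‖ ≤ s_j` (`j ≥ 2`) satisfies `‖r_n‖ ≤ r̄_n`. [this track, ATTEMPT-19 §2; folklore] -/
theorem norm_le_majorSeq {S r : ℕ → ℂ} {s : ℕ → ℝ} (hr0 : r 0 = 1)
    (hrec : ∀ n : ℕ, ((n : ℂ) + 1) * r (n + 1) = -∑ i ∈ Finset.range n, S (i + 2) * r (n - 1 - i))
    (hS : ∀ j, 2 ≤ j → ‖S j‖ ≤ s j) : ∀ n, ‖r n‖ ≤ majorSeq s n := by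
  have hs : ∀ j, 2 ≤ j → 0 ≤ s j := fun j hj => (norm_nonneg _).trans (hS j hj)
  intro n
  induction n using Nat.strong_induction_on with
  | _ n ih =>
    cases n with
    | zero => simp [hr0]
    | succ n =>
      have hn : ((n : ℂ) + 1) ≠ 0 := by
        rw [show ((n : ℂ) + 1) = ((n + 1 : ℕ) : ℂ) by push_cast; ring]
        exact_mod_cast Nat.succ_ne_zero n
      have e : r (n + 1) = -(∑ i ∈ Finset.range n, S (i + 2) * r (n - 1 - i)) / ((n : ℂ) + 1) := by
        rw [eq_div_iff hn, mul_comm]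
        exact hrec n
      have hn' : ‖((n : ℂ) + 1)‖ = (n : ℝ) + 1 := by
        rw [show ((n : ℂ) + 1) = ((n + 1 : ℕ) : ℂ) by push_cast; ring, Complex.norm_natCast]
        push_cast
        ring
      rw [e, norm_div, norm_neg, hn', majorSeq_succ]
      gcongr
      refine (norm_sum_le _ _).trans (Finset.sum_le_sum fun i hi => ?_)
      have hi' := Finset.mem_range.1 hi
      rw [norm_mul]
      exact mul_le_mul (hS _ (by omega)) (ih _ (by omega)) (norm_nonneg _) (hs _ (by omega))

/-! ## The discrete Grönwall bound -/

/-- The derivative inequality `T′(v) ≤ G′(v)·T(v)` for `v ≥ 0` (triangle re-summation + positivity). [this track, ATTEMPT-19 §2] -/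
theorem sum_succ_majorSeq_le {s : ℕ → ℝ} (hs : ∀ j, 2 ≤ j → 0 ≤ s j) (N : ℕ) {v : ℝ} (hv : 0 ≤ v) :
    ∑ n ∈ Finset.range N, ((n : ℝ) + 1) * majorSeq s (n + 1) * v ^ n ≤
      (∑ m ∈ Finset.range (N - 1), s (m + 2) * v ^ (m + 1)) *
        ∑ i ∈ Finset.range (N + 1), majorSeq s i * v ^ i := by
  have hr := majorSeq_nonneg hs
  cases N with
  | zero => simp
  | succ M =>
    rw [show M + 1 - 1 = M from rfl]
    -- rewrite the left side with the recursion and peel the `n = 0` term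
    have hL : ∑ n ∈ Finset.range (M + 1), ((n : ℝ) + 1) * majorSeq s (n + 1) * v ^ n =
        ∑ m ∈ Finset.range M, ∑ k ∈ Finset.range (m + 1), s (k + 2) * majorSeq s (m - k) * v ^ (k + (m - k) + 1) := by
      rw [Finset.sum_range_succ']
      simp only [Nat.cast_zero, zero_add, one_mul, majorSeq_one, pow_zero, mul_one, add_zero]
      refine Finset.sum_congr rfl fun m _ => ?_
      rw [majorSeq_succ_mul, Finset.sum_mul]
      refine Finset.sum_congr rfl fun k hk => ?_
      have hk' := Finset.mem_range.1 hk
      rw [show m + 1 - 1 - k = m - k by omega, show k + (m - k) + 1 = m + 1 by omega]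
    rw [hL, Finset.sum_range_diag_flip M (fun k j => s (k + 2) * majorSeq s j * v ^ (k + j + 1))]
    -- now each inner sum is a partial sum of `T(v)`
    rw [Finset.sum_mul]
    refine Finset.sum_le_sum fun m hm => ?_
    have hm' := Finset.mem_range.1 hm
    have e : ∑ k ∈ Finset.range (M - m), s (m + 2) * majorSeq s k * v ^ (m + k + 1) =
        s (m + 2) * v ^ (m + 1) * ∑ k ∈ Finset.range (M - m), majorSeq s k * v ^ k := by
      rw [Finset.mul_sum]
      refine Finset.sum_congr rfl fun k _ => ?_
      rw [show m + k + 1 = (m + 1) + k by ring, pow_add]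
      ring
    rw [e]
    refine mul_le_mul_of_nonneg_left ?_ (mul_nonneg (hs _ (by omega)) (pow_nonneg hv _))
    exact Finset.sum_le_sum_of_subset_of_nonneg (Finset.range_subset_range.2 (by omega))
      fun k _ _ => mul_nonneg (hr k) (pow_nonneg hv _)

/-- **Discrete Grönwall.** For `u ≥ 0` and every `N`: `Σ_{i≤N} r̄_i u^i ≤ exp(Σ_{m<N−1} s_{m+2}u^{m+2}/(m+2))`.
[this track, ATTEMPT-19 §2; folklore (Grönwall)] -/
theorem sum_majorSeq_mul_pow_le_exp {s : ℕ → ℝ} (hs : ∀ j, 2 ≤ j → 0 ≤ s j) (N : ℕ) {u : ℝ} (hu : 0 ≤ u) :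
    ∑ i ∈ Finset.range (N + 1), majorSeq s i * u ^ i ≤
      Real.exp (∑ m ∈ Finset.range (N - 1), s (m + 2) / ((m : ℝ) + 2) * u ^ (m + 2)) := by
  set T : ℝ → ℝ := fun v => ∑ i ∈ Finset.range (N + 1), majorSeq s i * v ^ i with hT
  set T' : ℝ → ℝ := fun v => ∑ i ∈ Finset.range (N + 1), majorSeq s i * ((i : ℝ) * v ^ (i - 1)) with hT'
  set G : ℝ → ℝ := fun v => ∑ m ∈ Finset.range (N - 1), s (m + 2) / ((m : ℝ) + 2) * v ^ (m + 2) with hG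
  set G' : ℝ → ℝ := fun v => ∑ m ∈ Finset.range (N - 1), s (m + 2) * v ^ (m + 1) with hG'
  have hTd : ∀ v, HasDerivAt T (T' v) v := fun v =>
    HasDerivAt.fun_sum fun i _ => (hasDerivAt_pow i v).const_mul (majorSeq s i)
  have hGd : ∀ v, HasDerivAt G (G' v) v := by
    intro v
    have h := HasDerivAt.fun_sum (u := Finset.range (N - 1))
      (A := fun m w => s (m + 2) / ((m : ℝ) + 2) * w ^ (m + 2))
      (A' := fun m => s (m + 2) / ((m : ℝ) + 2) * (((m + 2 : ℕ) : ℝ) * v ^ (m + 2 - 1))) (x := v)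
      fun m _ => (hasDerivAt_pow (m + 2) v).const_mul _
    have e : ∑ m ∈ Finset.range (N - 1), s (m + 2) / ((m : ℝ) + 2) * (((m + 2 : ℕ) : ℝ) * v ^ (m + 2 - 1)) = G' v := by
      refine Finset.sum_congr rfl fun m _ => ?_
      rw [show m + 2 - 1 = m + 1 from rfl]
      push_cast
      field_simp
    rw [e] at h
    exact h
  -- `T′ = Σ_{n<N} (n+1) r̄_{n+1} vⁿ`
  have hT'eq : ∀ v, T' v = ∑ n ∈ Finset.range N, ((n : ℝ) + 1) * majorSeq s (n + 1) * v ^ n := by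
    intro v
    simp only [hT']
    rw [Finset.sum_range_succ']
    simp only [Nat.cast_zero, zero_mul, mul_zero, add_zero, Nat.cast_add, Nat.cast_one, Nat.add_sub_cancel]
    exact Finset.sum_congr rfl fun n _ => by ring
  -- the product `F = T·e^{−G}` is non-increasing on `[0, ∞)`
  set F : ℝ → ℝ := fun v => T v * Real.exp (-G v) with hF
  have hFd : ∀ v, HasDerivAt F (T' v * Real.exp (-G v) + T v * (Real.exp (-G v) * -G' v)) v :=
    fun v => (hTd v).mul (hGd v).neg.exp
  have hanti : AntitoneOn F (Set.Ici 0) := by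
    refine antitoneOn_of_deriv_nonpos (convex_Ici 0) (fun v _ => (hFd v).continuousAt.continuousWithinAt)
      (fun v _ => (hFd v).differentiableAt.differentiableWithinAt) fun v hv => ?_
    rw [interior_Ici] at hv
    have hv0 : 0 ≤ v := le_of_lt hv
    rw [(hFd v).deriv]
    have key : T' v ≤ G' v * T v := by
      rw [hT'eq]
      exact sum_succ_majorSeq_le hs N hv0
    have hexp : 0 < Real.exp (-G v) := Real.exp_pos _
    nlinarith
  have h0 : F 0 = 1 := by
    simp only [hF, hT, hG]
    rw [Finset.sum_range_succ']
    simp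
  have hFu : F u ≤ 1 := h0 ▸ hanti (Set.mem_Ici.2 le_rfl) (Set.mem_Ici.2 hu) hu
  have hexp : 0 < Real.exp (-G u) := Real.exp_pos _
  have : T u ≤ Real.exp (G u) := by
    have h1 : T u * Real.exp (-G u) ≤ 1 := hFu
    rw [Real.exp_neg] at h1
    rwa [mul_inv_le_iff₀ (Real.exp_pos _), one_mul] at h1
  exact this

/-- **Cauchy-type bound**: `r̄_n ≤ e^{G_n(u)}/uⁿ` for every `u > 0`. [this track, ATTEMPT-19 §2] -/
theorem majorSeq_le_exp_div_pow {s : ℕ → ℝ} (hs : ∀ j, 2 ≤ j → 0 ≤ s j) (n : ℕ) {u : ℝ} (hu : 0 < u) :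
    majorSeq s n ≤ Real.exp (∑ m ∈ Finset.range (n - 1), s (m + 2) / ((m : ℝ) + 2) * u ^ (m + 2)) / u ^ n := by
  rw [le_div_iff₀ (pow_pos hu n)]
  refine le_trans ?_ (sum_majorSeq_mul_pow_le_exp hs n hu.le)
  exact Finset.single_le_sum (f := fun i => majorSeq s i * u ^ i)
    (fun i _ => mul_nonneg (majorSeq_nonneg hs i) (pow_nonneg hu.le i)) (Finset.mem_range.2 (Nat.lt_succ_self n))

/-- The cumulant polynomial is non-decreasing in its length. [this track, ATTEMPT-19 §2] -/
theorem cumulantSum_mono {s : ℕ → ℝ} (hs : ∀ j, 2 ≤ j → 0 ≤ s j) {j n : ℕ} (hjn : j ≤ n) {u : ℝ} (hu : 0 ≤ u) :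
    ∑ m ∈ Finset.range (j - 1), s (m + 2) / ((m : ℝ) + 2) * u ^ (m + 2) ≤
      ∑ m ∈ Finset.range (n - 1), s (m + 2) / ((m : ℝ) + 2) * u ^ (m + 2) :=
  Finset.sum_le_sum_of_subset_of_nonneg (Finset.range_subset_range.2 (by omega))
    fun m _ _ => mul_nonneg (div_nonneg (hs _ (by omega)) (by positivity)) (pow_nonneg hu _)

/-! ## Sequences of the form `h = e^{−pX}·r` -/

/-- **Main-range bound.** If `h_n = Σ_{j≤n} (−p)^{n−j}/(n−j)!·r_j` with `p > 0` and `r` as in `norm_le_majorSeq`, then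
`‖h_n − (−p)ⁿ/n!‖ ≤ (pⁿ/n!)·(exp(G_n(n/p)) − 1)`, `G_n(u) = Σ_{m<n−1} s_{m+2}u^{m+2}/(m+2)`. [this track, ATTEMPT-16 Lemma D1 (i); ATTEMPT-19 §2] -/
theorem norm_sub_le_mul_expm1 {S r h : ℕ → ℂ} {s : ℕ → ℝ} {p : ℝ} (hp : 0 < p) (hr0 : r 0 = 1)
    (hrec : ∀ n : ℕ, ((n : ℂ) + 1) * r (n + 1) = -∑ i ∈ Finset.range n, S (i + 2) * r (n - 1 - i))
    (hS : ∀ j, 2 ≤ j → ‖S j‖ ≤ s j)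
    (hconv : ∀ n : ℕ, h n = ∑ j ∈ Finset.range (n + 1), ((-p : ℝ) : ℂ) ^ (n - j) / ((n - j).factorial : ℂ) * r j)
    (n : ℕ) :
    ‖h n - ((-p : ℝ) : ℂ) ^ n / (n.factorial : ℂ)‖ ≤
      p ^ n / (n.factorial : ℝ) *
        (Real.exp (∑ m ∈ Finset.range (n - 1), s (m + 2) / ((m : ℝ) + 2) * ((n : ℝ) / p) ^ (m + 2)) - 1) := by
  have hs : ∀ j, 2 ≤ j → 0 ≤ s j := fun j hj => (norm_nonneg _).trans (hS j hj)
  have hdom := norm_le_majorSeq hr0 hrec hS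
  have hr1 : r 1 = 0 := by
    have := hrec 0
    simp only [Nat.cast_zero, zero_add, one_mul, Finset.range_zero, Finset.sum_empty, neg_zero] at this
    exact this
  cases n with
  | zero =>
    simp [hconv, hr0]
  | succ n =>
    -- peel the `j = 0` and `j = 1` terms
    have e : h (n + 1) - ((-p : ℝ) : ℂ) ^ (n + 1) / ((n + 1).factorial : ℂ) =
        ∑ j ∈ Finset.range n,
          ((-p : ℝ) : ℂ) ^ (n + 1 - (j + 2)) / ((n + 1 - (j + 2)).factorial : ℂ) * r (j + 2) := by
      rw [hconv, Finset.sum_range_succ', Finset.sum_range_succ']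
      simp only [Nat.zero_add, Nat.sub_zero, hr0, hr1, mul_one, mul_zero, add_zero, add_sub_cancel_right]
    rw [e]
    -- termwise: `p^{n+1-(j+2)}/(n+1-(j+2))! ≤ (p^{n+1}/(n+1)!)·((n+1)/p)^{j+2}` and `‖r_{j+2}‖ ≤ r̄_{j+2}`
    have hterm : ∀ j ∈ Finset.range n,
        ‖((-p : ℝ) : ℂ) ^ (n + 1 - (j + 2)) / ((n + 1 - (j + 2)).factorial : ℂ) * r (j + 2)‖ ≤
          (p ^ (n + 1) / ((n + 1).factorial : ℝ) * (((n + 1 : ℕ) : ℝ) / p) ^ (j + 2)) * majorSeq s (j + 2) := by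
      intro j hj
      have hj' : j + 2 ≤ n + 1 := by have := Finset.mem_range.1 hj; omega
      rw [norm_mul, norm_div, norm_pow, Complex.norm_real, Real.norm_eq_abs, abs_neg, abs_of_pos hp,
        Complex.norm_natCast]
      have hfac : ((n + 1 - (j + 2)).factorial : ℝ) * ((n + 1).descFactorial (j + 2) : ℝ) = ((n + 1).factorial : ℝ) := by
        exact_mod_cast Nat.factorial_mul_descFactorial hj'
      have hdesc : ((n + 1).descFactorial (j + 2) : ℝ) ≤ ((n + 1 : ℕ) : ℝ) ^ (j + 2) := by
        exact_mod_cast Nat.descFactorial_le_pow (n + 1) (j + 2)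
      have hf1 : (0 : ℝ) < ((n + 1 - (j + 2)).factorial : ℝ) := by exact_mod_cast Nat.factorial_pos _
      have hf2 : (0 : ℝ) < ((n + 1).factorial : ℝ) := by exact_mod_cast Nat.factorial_pos _
      have hkey : p ^ (n + 1 - (j + 2)) / ((n + 1 - (j + 2)).factorial : ℝ) ≤
          p ^ (n + 1) / ((n + 1).factorial : ℝ) * (((n + 1 : ℕ) : ℝ) / p) ^ (j + 2) := by
        rw [div_pow, show p ^ (n + 1) = p ^ (n + 1 - (j + 2)) * p ^ (j + 2) by rw [← pow_add]; congr 1; omega]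
        rw [div_le_iff₀ hf1]
        have : p ^ (n + 1 - (j + 2)) * p ^ (j + 2) / ((n + 1).factorial : ℝ) * ((((n + 1 : ℕ) : ℝ)) ^ (j + 2) / p ^ (j + 2)) *
            ((n + 1 - (j + 2)).factorial : ℝ) =
            p ^ (n + 1 - (j + 2)) * ((((n + 1 : ℕ) : ℝ) ^ (j + 2) * ((n + 1 - (j + 2)).factorial : ℝ)) / ((n + 1).factorial : ℝ)) := by
          field_simp
        rw [this]
        refine le_mul_of_one_le_right (pow_nonneg hp.le _) ?_
        rw [one_le_div hf2, ← hfac, mul_comm]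
        exact mul_le_mul_of_nonneg_right hdesc hf1.le
      exact mul_le_mul hkey (hdom _) (norm_nonneg _) (by positivity)
    refine (norm_sum_le _ _).trans ((Finset.sum_le_sum hterm).trans ?_)
    have hfac : ∑ j ∈ Finset.range n, (p ^ (n + 1) / ((n + 1).factorial : ℝ) * (((n + 1 : ℕ) : ℝ) / p) ^ (j + 2)) *
        majorSeq s (j + 2) = p ^ (n + 1) / ((n + 1).factorial : ℝ) *
          ∑ j ∈ Finset.range n, majorSeq s (j + 2) * (((n + 1 : ℕ) : ℝ) / p) ^ (j + 2) := by
      rw [Finset.mul_sum]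
      exact Finset.sum_congr rfl fun j _ => by ring
    rw [hfac]
    refine mul_le_mul_of_nonneg_left ?_ (by positivity)
    -- the Grönwall bound: `Σ_{j<n} r̄_{j+2} u^{j+2} = T_{n+1}(u) − 1 ≤ e^{G} − 1`
    have hu : 0 ≤ (((n + 1 : ℕ) : ℝ)) / p := by positivity
    have hG := sum_majorSeq_mul_pow_le_exp hs (n + 1) hu
    rw [Finset.sum_range_succ', Finset.sum_range_succ'] at hG
    simp only [Nat.zero_add, majorSeq_zero, pow_zero, mul_one, majorSeq_one, zero_mul, add_zero,
      show ∀ x : ℕ, x + 1 + 1 = x + 2 from fun x => rfl] at hG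
    linarith

/-- **Tail bound.** Under the same hypotheses, for every `u > 0`: `‖h_n‖ ≤ e^{pu + G_n(u)}/uⁿ`.
[this track, ATTEMPT-16 Lemma D1 (iv) replaced; ATTEMPT-19 §2] -/
theorem norm_le_exp_div_pow {S r h : ℕ → ℂ} {s : ℕ → ℝ} {p : ℝ} (hp : 0 ≤ p) (hr0 : r 0 = 1)
    (hrec : ∀ n : ℕ, ((n : ℂ) + 1) * r (n + 1) = -∑ i ∈ Finset.range n, S (i + 2) * r (n - 1 - i))
    (hS : ∀ j, 2 ≤ j → ‖S j‖ ≤ s j)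
    (hconv : ∀ n : ℕ, h n = ∑ j ∈ Finset.range (n + 1), ((-p : ℝ) : ℂ) ^ (n - j) / ((n - j).factorial : ℂ) * r j)
    (n : ℕ) {u : ℝ} (hu : 0 < u) :
    ‖h n‖ ≤ Real.exp (p * u + ∑ m ∈ Finset.range (n - 1), s (m + 2) / ((m : ℝ) + 2) * u ^ (m + 2)) / u ^ n := by
  have hs : ∀ j, 2 ≤ j → 0 ≤ s j := fun j hj => (norm_nonneg _).trans (hS j hj)
  have hdom := norm_le_majorSeq hr0 hrec hS
  set G := ∑ m ∈ Finset.range (n - 1), s (m + 2) / ((m : ℝ) + 2) * u ^ (m + 2) with hGdef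
  -- termwise: `‖(−p)^{n−j}/(n−j)!·r_j‖ ≤ (p^{n−j}/(n−j)!)·e^{G}/u^j = (e^G/uⁿ)·(pu)^{n−j}/(n−j)!`
  have hterm : ∀ j ∈ Finset.range (n + 1),
      ‖((-p : ℝ) : ℂ) ^ (n - j) / ((n - j).factorial : ℂ) * r j‖ ≤
        Real.exp G / u ^ n * ((p * u) ^ (n - j) / ((n - j).factorial : ℝ)) := by
    intro j hj
    have hj' : j ≤ n := Nat.lt_succ_iff.1 (Finset.mem_range.1 hj)
    rw [norm_mul, norm_div, norm_pow, Complex.norm_real, Real.norm_eq_abs, abs_neg, abs_of_nonneg hp,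
      Complex.norm_natCast]
    have h1 : ‖r j‖ ≤ Real.exp G / u ^ j := by
      refine (hdom j).trans ((majorSeq_le_exp_div_pow hs j hu).trans ?_)
      exact div_le_div_of_nonneg_right (Real.exp_le_exp.2 (cumulantSum_mono hs hj' hu.le)) (pow_nonneg hu.le _)
    have h2 : p ^ (n - j) / ((n - j).factorial : ℝ) * (Real.exp G / u ^ j) =
        Real.exp G / u ^ n * ((p * u) ^ (n - j) / ((n - j).factorial : ℝ)) := by
      rw [mul_pow, show u ^ n = u ^ (n - j) * u ^ j by rw [← pow_add, Nat.sub_add_cancel hj']]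
      field_simp
    rw [← h2]
    exact mul_le_mul_of_nonneg_left h1 (by positivity)
  rw [hconv]
  refine (norm_sum_le _ _).trans ((Finset.sum_le_sum hterm).trans ?_)
  have hrefl : ∑ i ∈ Finset.range (n + 1), (p * u) ^ (n - i) / ((n - i).factorial : ℝ) =
      ∑ k ∈ Finset.range (n + 1), (p * u) ^ k / (k.factorial : ℝ) := by
    have := Finset.sum_range_reflect (fun k => (p * u) ^ k / (k.factorial : ℝ)) (n + 1)
    simp only [Nat.add_sub_cancel] at this
    exact this
  rw [← Finset.mul_sum, hrefl]
  have hE := Real.sum_le_exp_of_nonneg (mul_nonneg hp hu.le) (n + 1)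
  have hpos : 0 ≤ Real.exp G / u ^ n := by positivity
  calc Real.exp G / u ^ n * (∑ k ∈ Finset.range (n + 1), (p * u) ^ k / (k.factorial : ℝ))
      ≤ Real.exp G / u ^ n * Real.exp (p * u) := mul_le_mul_of_nonneg_left hE hpos
    _ = Real.exp (p * u + G) / u ^ n := by rw [Real.exp_add]; ring

/-! ## The geometric cumulant bound -/

/-- If `s_j ≤ j·W^{j−1}·P` for `j ≥ 2` (`W, P ≥ 0`) then `G_n(u) ≤ 2PWu²` whenever `0 ≤ u` and `Wu ≤ ½`.
[this track, ATTEMPT-19 §2] -/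
theorem cumulantSum_le {s : ℕ → ℝ} {W P : ℝ} (hW : 0 ≤ W) (hP : 0 ≤ P)
    (hs : ∀ j, 2 ≤ j → s j ≤ (j : ℝ) * W ^ (j - 1) * P) (n : ℕ) {u : ℝ} (hu : 0 ≤ u) (hWu : W * u ≤ 1 / 2) :
    ∑ m ∈ Finset.range (n - 1), s (m + 2) / ((m : ℝ) + 2) * u ^ (m + 2) ≤ 2 * P * W * u ^ 2 := by
  have hterm : ∀ m ∈ Finset.range (n - 1),
      s (m + 2) / ((m : ℝ) + 2) * u ^ (m + 2) ≤ P * W * u ^ 2 * (1 / 2) ^ m := by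
    intro m _
    have h1 : s (m + 2) / ((m : ℝ) + 2) ≤ W ^ (m + 1) * P := by
      rw [div_le_iff₀ (by positivity)]
      have := hs (m + 2) (by omega)
      rw [show m + 2 - 1 = m + 1 from rfl] at this
      push_cast at this
      linarith
    calc s (m + 2) / ((m : ℝ) + 2) * u ^ (m + 2) ≤ W ^ (m + 1) * P * u ^ (m + 2) :=
          mul_le_mul_of_nonneg_right h1 (pow_nonneg hu _)
      _ = P * W * u ^ 2 * (W * u) ^ m := by ring
      _ ≤ P * W * u ^ 2 * (1 / 2) ^ m := by
          refine mul_le_mul_of_nonneg_left (pow_le_pow_left₀ (mul_nonneg hW hu) hWu m) (by positivity)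
  refine (Finset.sum_le_sum hterm).trans ?_
  rw [← Finset.mul_sum]
  have hgeom : ∑ m ∈ Finset.range (n - 1), (1 / 2 : ℝ) ^ m ≤ 2 := sum_geometric_two_le _
  nlinarith [mul_nonneg (mul_nonneg hP hW) (sq_nonneg u)]

/-- **Main-range bound, geometric form**: `‖h_n − (−p)ⁿ/n!‖ ≤ (pⁿ/n!)(exp(2PWn²/p²) − 1)` when `W·n ≤ p/2`.
[this track, ATTEMPT-16 Lemma D1 (i)–(ii); ATTEMPT-19 §2] -/
theorem norm_sub_le_of_geometric {S r h : ℕ → ℂ} {W P p : ℝ} (hp : 0 < p) (hW : 0 ≤ W) (hP : 0 ≤ P)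
    (hr0 : r 0 = 1)
    (hrec : ∀ n : ℕ, ((n : ℂ) + 1) * r (n + 1) = -∑ i ∈ Finset.range n, S (i + 2) * r (n - 1 - i))
    (hS : ∀ j, 2 ≤ j → ‖S j‖ ≤ (j : ℝ) * W ^ (j - 1) * P)
    (hconv : ∀ n : ℕ, h n = ∑ j ∈ Finset.range (n + 1), ((-p : ℝ) : ℂ) ^ (n - j) / ((n - j).factorial : ℂ) * r j)
    {n : ℕ} (hn : W * n ≤ p / 2) :
    ‖h n - ((-p : ℝ) : ℂ) ^ n / (n.factorial : ℂ)‖ ≤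
      p ^ n / (n.factorial : ℝ) * (Real.exp (2 * P * W * (n : ℝ) ^ 2 / p ^ 2) - 1) := by
  have h1 := norm_sub_le_mul_expm1 hp hr0 hrec hS hconv n
  refine h1.trans (mul_le_mul_of_nonneg_left ?_ (by positivity))
  have hu : 0 ≤ (n : ℝ) / p := by positivity
  have hWu : W * ((n : ℝ) / p) ≤ 1 / 2 := by
    rw [← mul_div_assoc, div_le_iff₀ hp]
    linarith
  have h2 := cumulantSum_le (s := fun j => (j : ℝ) * W ^ (j - 1) * P) hW hP (fun j _ => le_rfl) n hu hWu
  have h3 : 2 * P * W * ((n : ℝ) / p) ^ 2 = 2 * P * W * (n : ℝ) ^ 2 / p ^ 2 := by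
    rw [div_pow]; ring
  rw [h3] at h2
  linarith [Real.exp_le_exp.2 h2]

/-- **Tail bound, geometric form**: `‖h_n‖ ≤ e^{pu + 2PWu²}/uⁿ` for every `u > 0` with `Wu ≤ ½`. [this track, ATTEMPT-19 §2] -/
theorem norm_le_of_geometric {S r h : ℕ → ℂ} {W P p : ℝ} (hp : 0 ≤ p) (hW : 0 ≤ W) (hP : 0 ≤ P)
    (hr0 : r 0 = 1)
    (hrec : ∀ n : ℕ, ((n : ℂ) + 1) * r (n + 1) = -∑ i ∈ Finset.range n, S (i + 2) * r (n - 1 - i))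
    (hS : ∀ j, 2 ≤ j → ‖S j‖ ≤ (j : ℝ) * W ^ (j - 1) * P)
    (hconv : ∀ n : ℕ, h n = ∑ j ∈ Finset.range (n + 1), ((-p : ℝ) : ℂ) ^ (n - j) / ((n - j).factorial : ℂ) * r j)
    (n : ℕ) {u : ℝ} (hu : 0 < u) (hWu : W * u ≤ 1 / 2) :
    ‖h n‖ ≤ Real.exp (p * u + 2 * P * W * u ^ 2) / u ^ n := by
  have h1 := norm_le_exp_div_pow hp hr0 hrec hS hconv n hu
  refine h1.trans (div_le_div_of_nonneg_right (Real.exp_le_exp.2 ?_) (pow_nonneg hu.le _))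
  have h2 := cumulantSum_le (s := fun j => (j : ℝ) * W ^ (j - 1) * P) hW hP (fun j _ => le_rfl) n hu.le hWu
  linarith

end Summit.RiemannHypothesis.RiemannHypothesis.Theorems.Handoff

end
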